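import Summits.BirchSwinnertonDyer.BirchSwinnertonDyer.Theorems.GenusKolyvaginAtTwoGenusPrimitiveSupplyAtTwoTwinConverse
import HarnessLib

/-!
# R-128 retype — print-form twins of `GenusKolyvaginAtTwoGenusPrimitiveSupplyAtTwoTwinConverse`

Seat `bsd-line-gk2-p2` g21 (cell `bsd-f1-sign2`), route `GenusKolyvaginAtTwo`, `--supports stmt-BirchSwinnertonDyer-22136`
(helper; closes nothing). Director-bsd R-128 RETYPE ORDER (2026-08-29 17:42Z; bsd-cited U-r05-BX, T-Q381-1′): the theorems
`stub_minimalTwinSupplyAtTwo_of_twoConverse'`, `stub_minimalTwinSupplyAtTwo_of_rankOneTwoConverse'`, 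
of `Summits.BirchSwinnertonDyer.BirchSwinnertonDyer.Theorems.GenusKolyvaginAtTwoGenusPrimitiveSupplyAtTwoTwinConverse` take the BARE closure
`∀ V : WeierstrassCurve ℚ, p_parity V 2` (all Weierstrass cubics, singular included — off print and undischargeable by any
faithful Dokchitser–Dokchitser discharge). This file declares their PRIMED TWINS with the hypothesis in print form
`∀ (V : WeierstrassCurve ℚ) [V.IsElliptic], p_parity V 2` (= route item `TwoParityDD` since rev 34); statements and proofs are
otherwise identical (every application `hpar W` is at an elliptic curve), calls to other retyped theorems go to their twins.
The tree is append-only, so the originals stay (superseded); the file is over the 400-line budget of the original, hence separate.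
THEOREMS ONLY; no definition, no named fact, no `sorry`. BSD is NOT proved by any of this; nothing is closed.
-/

set_option linter.dupNamespace false -- tree convention: `Summit.BirchSwinnertonDyer.BirchSwinnertonDyer.Theorems` (summit = sub-problem)

noncomputable section

open scoped AddSubgroup

namespace Summit.BirchSwinnertonDyer.BirchSwinnertonDyer.Theorems.GenusKoly

open NumberField WeierstrassCurve Literature.NumberTheory.EllipticCurves
  Literature.NumberTheory.EllipticCurves.ModularForms

/-! ## R-128 retype (director-bsd 2026-08-29 17:42Z, T-Q381-1′; seat bsd-line-gk2-p2 g21): PRINT-FORM TWINS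
Every theorem below is the byte-identical twin of the theorem of the same name without the trailing prime, with the ONE change
that the `2`-parity hypothesis is typed as print has it — `∀ (V : WeierstrassCurve ℚ) [V.IsElliptic], p_parity V 2`
(Dokchitser–Dokchitser 2010 Thm. 1.4, elliptic curves; = route item `TwoParityDD` after rev 34) — instead of the bare closure
`∀ V : WeierstrassCurve ℚ, p_parity V 2` over all Weierstrass cubics (singular ones included: off print, undischargeable).
Calls to other retyped theorems go to their primed twins; every application `hpar W` is at an elliptic curve, so the proofs are
unchanged. The unprimed originals are kept (append-only tree) and are superseded by these. BSD is NOT proved by any of this. -/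


/-- **R-128 retype** (director-bsd 2026-08-29, T-Q381-1′) of `stub_minimalTwinSupplyAtTwo_of_twoConverse`: the SAME statement and proof with the `2`-parity hypothesis in PRINT form `∀ (V : WeierstrassCurve ℚ) [V.IsElliptic], p_parity V 2` (Dokchitser–Dokchitser 2010 Thm. 1.4 is about elliptic curves; the bare closure over all Weierstrass cubics was off print). **STUB A ⟸ (SUPPLY) ∧ (CONV₂), modulo Modularity and the `2`-parity theorem.** For `E` in the A-class (globally
minimal `W`, non-CM, `r_an(E) = 0`, `ρ_{E,2^n}` onto for all `n ≥ 1`): if (SUPPLY) some Kolyvagin-(H2)-admissible Heegner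
field `K` (odd `d_K ≠ −3`, every `q ∣ N_E` split, `d_K·(−|Δ|)` and `d_K·(−2|Δ|)` non-squares) has a globally minimal
`Wd ≅ E^{(d_K)}` with `#Sel₂(Wd) = 2`, and (CONV₂) every non-CM globally minimal `V/ℚ` with `corank_{ℤ₂} Sel_{2^∞}(V/ℚ) = 1`
has `ord_{s=1} L(V,s) = 1`, then the registered stub `stub_minimalTwinSupplyAtTwo` of line `genus-supply` holds VERBATIM:
that very `Wd` has `r_an(Wd) = 1`. Published inputs: `exists_isNewformOf` (BCDT 2001), `p_parity · 2`
(Dokchitser–Dokchitser 2010); everything else is a theorem of the tree (§1). (CONV₂) is OPEN (crux 19220 of route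
`TwoAdicConverse`, here without its reduction-type clause); (SUPPLY) is Mazur–Rubin-type. Stub A is therefore (SUPPLY)
modulo the `2`-converse — not an independent open problem. BSD is not proved by any of this.
[cite: DokchitserDokchitserAnnals2010, Thm. 1.4] [cite: Darmon2004, §3.6 Thm. 3.17] [cite: SilvermanAEC2009, Thm. X.4.2]
[cite: Greenberg1999, §1] [cite: MazurRubin2010, Thm. 1.4 and Prop. 3.3] -/
theorem stub_minimalTwinSupplyAtTwo_of_twoConverse' (hmod : exists_isNewformOf)
    (hpar : ∀ (V : WeierstrassCurve ℚ) [V.IsElliptic], p_parity V 2)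
    (hconv : ∀ (V : WeierstrassCurve ℚ) [V.IsElliptic] [V.IsGloballyMinimal],
      ¬ V.HasCM → V.selmerCorank 2 = 1 → V.analyticRank = 1)
    (hsupply : ∀ (W : WeierstrassCurve ℚ) [W.IsElliptic] [W.IsGloballyMinimal] [NeZero (W.conductorNorm ℤ)],
      ¬ W.HasCM → W.analyticRank = 0 → (∀ n : ℕ, 0 < n → W.HasSurjectiveModNGaloisRep ((2 : ℤ) ^ n)) →
      ∃ (K : Type) (_ : Field K) (_ : NumberField K),
        IsImaginaryQuadratic K ∧ Odd (NumberField.discr K) ∧ NumberField.discr K ≠ -3 ∧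
        SatisfiesHeegnerHypothesis (W.conductorNorm ℤ) K ∧
        ¬ IsSquare ((NumberField.discr K : ℚ) * -|W.Δ|) ∧ ¬ IsSquare ((NumberField.discr K : ℚ) * (-(2 * |W.Δ|))) ∧
        ∃ (Wd : WeierstrassCurve ℚ) (_ : Wd.IsElliptic) (_ : Wd.IsGloballyMinimal),
          (∃ C : WeierstrassCurve.VariableChange ℚ, C • W.quadraticTwist (NumberField.discr K : ℚ) = Wd) ∧
          Nat.card (Wd.selmerGroup 2) = 2) :
    ∀ (W : WeierstrassCurve ℚ) [W.IsElliptic] [W.IsGloballyMinimal] [NeZero (W.conductorNorm ℤ)],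
      ¬ W.HasCM → W.analyticRank = 0 → (∀ n : ℕ, 0 < n → W.HasSurjectiveModNGaloisRep ((2 : ℤ) ^ n)) →
      ∃ (K : Type) (_ : Field K) (_ : NumberField K),
        IsImaginaryQuadratic K ∧ Odd (NumberField.discr K) ∧ NumberField.discr K ≠ -3 ∧
        SatisfiesHeegnerHypothesis (W.conductorNorm ℤ) K ∧
        ¬ IsSquare ((NumberField.discr K : ℚ) * -|W.Δ|) ∧ ¬ IsSquare ((NumberField.discr K : ℚ) * (-(2 * |W.Δ|))) ∧
        ∃ (Wd : WeierstrassCurve ℚ) (_ : Wd.IsElliptic) (_ : Wd.IsGloballyMinimal),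
          (∃ C : WeierstrassCurve.VariableChange ℚ, C • W.quadraticTwist (NumberField.discr K : ℚ) = Wd) ∧
          Wd.analyticRank = 1 ∧ Nat.card (Wd.selmerGroup 2) = 2 := by
  intro W _ _ _ hcm hr0 hρ
  obtain ⟨K, iF, iN, hIQ, hodd, h3, hHe, hsq1, hsq2, Wd, iE, iM, hWd, hSel⟩ := hsupply W hcm hr0 hρ
  refine ⟨K, iF, iN, hIQ, hodd, h3, hHe, hsq1, hsq2, Wd, iE, iM, hWd, ?_, hSel⟩
  have hd : (NumberField.discr K : ℚ) ≠ 0 := by exact_mod_cast NumberField.discr_ne_zero K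
  have hcmd : ¬ Wd.HasCM := twin_not_hasCM W hcm hd Wd hWd
  have htors := natCard_twoTorsion_twin_eq_one W (hρ 1 one_pos) hd Wd hWd
  have hw := rootNumber_twin_eq_neg_one hmod W hr0 K hIQ hHe Wd hWd
  have hco := selmerCorank_two_eq_one_of_card_selmerGroup_two Wd htors hSel
    (odd_selmerCorank_two_of_p_parity Wd (hpar Wd) hw)
  exact hconv Wd hcmd hco


/-- **R-128 retype** (director-bsd 2026-08-29, T-Q381-1′) of `stub_minimalTwinSupplyAtTwo_of_rankOneTwoConverse`: the SAME statement and proof with the `2`-parity hypothesis in PRINT form `∀ (V : WeierstrassCurve ℚ) [V.IsElliptic], p_parity V 2` (Dokchitser–Dokchitser 2010 Thm. 1.4 is about elliptic curves; the bare closure over all Weierstrass cubics was off print). **STUB A ⟸ (SUPPLY′) ∧ `RankOneTwoConverse` (crux stmt-BirchSwinnertonDyer-19220 of route `TwoAdicConverse`, BY NAME),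
modulo Modularity and `2`-parity.** Same as `stub_minimalTwinSupplyAtTwo_of_twoConverse'`, with the `2`-converse taken to be
the tree's typed crux `Summit.BirchSwinnertonDyer.BirchSwinnertonDyer.Theses.TwoAdicConverse.RankOneTwoConverse` («non-CM,
good ordinary or multiplicative at `2`, `corank_{ℤ₂} Sel_{2^∞} = 1 ⟹ r_an = 1`»), and (SUPPLY′) = (SUPPLY) delivering a twin in
that reduction class (`Rank1Residual.GoodOrd Wd 2 ∨ Rank1Residual.Mult Wd 2`; for `d_K ≡ 1 (mod 8)` — forced when `2 ∣ N_E` —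
`E^{(d_K)} ≅ E` over `ℚ₂`, so this is the habitat's own reduction type at `2`). So on the good-ordinary-or-multiplicative
part of the habitat, stub A of crux 22136 is downstream of crux 19220. BSD is not proved by any of this.
[cite: DokchitserDokchitserAnnals2010, Thm. 1.4] [cite: Darmon2004, §3.6 Thm. 3.17] [cite: SilvermanAEC2009, Thm. X.4.2] -/
theorem stub_minimalTwinSupplyAtTwo_of_rankOneTwoConverse' (hmod : exists_isNewformOf)
    (hpar : ∀ (V : WeierstrassCurve ℚ) [V.IsElliptic], p_parity V 2)
    (hconv : Summit.BirchSwinnertonDyer.BirchSwinnertonDyer.Theses.TwoAdicConverse.RankOneTwoConverse)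
    (hsupply : ∀ (W : WeierstrassCurve ℚ) [W.IsElliptic] [W.IsGloballyMinimal] [NeZero (W.conductorNorm ℤ)],
      ¬ W.HasCM → W.analyticRank = 0 → (∀ n : ℕ, 0 < n → W.HasSurjectiveModNGaloisRep ((2 : ℤ) ^ n)) →
      ∃ (K : Type) (_ : Field K) (_ : NumberField K),
        IsImaginaryQuadratic K ∧ Odd (NumberField.discr K) ∧ NumberField.discr K ≠ -3 ∧
        SatisfiesHeegnerHypothesis (W.conductorNorm ℤ) K ∧
        ¬ IsSquare ((NumberField.discr K : ℚ) * -|W.Δ|) ∧ ¬ IsSquare ((NumberField.discr K : ℚ) * (-(2 * |W.Δ|))) ∧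
        ∃ (Wd : WeierstrassCurve ℚ) (_ : Wd.IsElliptic) (_ : Wd.IsGloballyMinimal),
          (∃ C : WeierstrassCurve.VariableChange ℚ, C • W.quadraticTwist (NumberField.discr K : ℚ) = Wd) ∧
          Nat.card (Wd.selmerGroup 2) = 2 ∧
          (haveI : Fact (Nat.Prime 2) := ⟨Nat.prime_two⟩
           Rank1Residual.GoodOrd Wd 2 ∨ Rank1Residual.Mult Wd 2)) :
    ∀ (W : WeierstrassCurve ℚ) [W.IsElliptic] [W.IsGloballyMinimal] [NeZero (W.conductorNorm ℤ)],
      ¬ W.HasCM → W.analyticRank = 0 → (∀ n : ℕ, 0 < n → W.HasSurjectiveModNGaloisRep ((2 : ℤ) ^ n)) →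
      ∃ (K : Type) (_ : Field K) (_ : NumberField K),
        IsImaginaryQuadratic K ∧ Odd (NumberField.discr K) ∧ NumberField.discr K ≠ -3 ∧
        SatisfiesHeegnerHypothesis (W.conductorNorm ℤ) K ∧
        ¬ IsSquare ((NumberField.discr K : ℚ) * -|W.Δ|) ∧ ¬ IsSquare ((NumberField.discr K : ℚ) * (-(2 * |W.Δ|))) ∧
        ∃ (Wd : WeierstrassCurve ℚ) (_ : Wd.IsElliptic) (_ : Wd.IsGloballyMinimal),
          (∃ C : WeierstrassCurve.VariableChange ℚ, C • W.quadraticTwist (NumberField.discr K : ℚ) = Wd) ∧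
          Wd.analyticRank = 1 ∧ Nat.card (Wd.selmerGroup 2) = 2 := by
  haveI : Fact (Nat.Prime 2) := ⟨Nat.prime_two⟩
  intro W _ _ _ hcm hr0 hρ
  obtain ⟨K, iF, iN, hIQ, hodd, h3, hHe, hsq1, hsq2, Wd, iE, iM, hWd, hSel, hred⟩ := hsupply W hcm hr0 hρ
  refine ⟨K, iF, iN, hIQ, hodd, h3, hHe, hsq1, hsq2, Wd, iE, iM, hWd, ?_, hSel⟩
  have hd : (NumberField.discr K : ℚ) ≠ 0 := by exact_mod_cast NumberField.discr_ne_zero K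
  have hcmd : ¬ Wd.HasCM := twin_not_hasCM W hcm hd Wd hWd
  have htors := natCard_twoTorsion_twin_eq_one W (hρ 1 one_pos) hd Wd hWd
  have hw := rootNumber_twin_eq_neg_one hmod W hr0 K hIQ hHe Wd hWd
  have hco := selmerCorank_two_eq_one_of_card_selmerGroup_two Wd htors hSel
    (odd_selmerCorank_two_of_p_parity Wd (hpar Wd) hw)
  exact hconv Wd hcmd hred hco


end Summit.BirchSwinnertonDyer.BirchSwinnertonDyer.Theorems.GenusKoly

end
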